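import Literature.NumberTheory.Automorphic.AshSmithTheoryHeckeCharpolyProofs
import Literature.NumberTheory.GaloisRepresentations.ArtinFormalismInductionProofs
import HarnessLib

/-!
# Ash (2003), *Smith theory and Hecke operators* — proofs towards the named fact
# `Ash2003_inducedRayClassCharacter_attached`: Frobenius of the induction of a character

Topic `NumberTheory/Automorphic`; third companion of
`Literature.NumberTheory.Automorphic.AshSmithTheoryHecke` (the named fact
`Ash2003_inducedRayClassCharacter_attached` = A. Ash, *Smith theory and Hecke operators*, J. Algebra
**259** (2003) 43–58 [Ash2003], Thm. 1.1 / Cor. 4.4).  The Galois half of the printed proof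
([Ash2003, Lemma 4.2], from Ash, Duke Math. J. 65 (1992), Thm. 6.1.2: "`ρ_θ = Ind(G_L, G_ℚ, θ)` is
attached to `χ_θ`") has Galois content `det(1 - ρ_θ(Frob_l) X) = ∏_{λ ∣ l} (1 - θ([λ]) X^{f})`.
This file proves the general number-field statement behind it:

* `FramedGaloisRep.exists_charpoly_induce_eq_prod` (dot-notation extension of the accepted
  `FramedGaloisRep`, declared here by absolute name): for a finite Galois extension of number fields
  `F/K`, a framed character `ρ : Γ_F → GL_1(A)` (any commutative ring `A`), a place `v` of `K`, a
  prime `𝔓 ∣ v` of `\bar ℤ_K` whose inertia group lies in `res(Γ_F)` (i.e. `v` unramified in `F`)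
  and an arithmetic Frobenius `σ` at `𝔓`:
  `det(X - Ind(ρ)(σ)) = ∏_{w ∣ v} (X^{f(w|v)} - ρ(s_w))` for arithmetic Frobenii `s_w ∈ Γ_F` at primes
  `𝔔_w ∣ w` of `\bar ℤ_F`;
* `Ash2003.orderOf_frobenius_eq_inertiaDeg`: the order of `σ` modulo `res(Γ_F)` is `f(w|v)` for every
  `w ∣ v`, and `τ_w⁻¹ σ^{f} τ_w` restricts to an arithmetic Frobenius of `F` at `𝔔_w`.

The specialisation to `L = ℚ(ζ_p)` and ray class characters (`Ash2003.IsGaloisAvatar`) is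
`Ash2003.hasFrobCharpolyAt_induce_of_isGaloisAvatar` in `AshSmithTheoryHeckeAttachedProofs`.

## Proof

The group theory is `Ash2003.charpoly_indMatrix_eq_prod` (`AshSmithTheoryHeckeCharpolyProofs`):
`det(X - Ind(χ)(σ)) = ∏_k (X^f - χ(s_k))` for representatives `τ_k` of `⟨σ⟩ \ Γ_K / Γ_F`,
`f = ord(σ̄)` and `res(s_k) = τ_k⁻¹ σ^f τ_k`.  The arithmetic, as in Neukirch VII §10, proof of
(10.4) (iv) (and the tree's `ArtinRep.eulerFactorAt_eq_prod_expand_of_isInducedFrom`, whose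
bookkeeping is followed line by line): the double cosets `⟨σ⟩ \ Γ_K / Γ_F` are the places `w ∣ v`
of `F`, via `τ ↦ ι(τ⁻¹ 𝔓) ∩ 𝓞 F` (transitivity of `Γ_K`, `Γ_F` on the primes above a place,
`IntegralGaloisAction`; `\bar ℤ_K ≅ \bar ℤ_F`, `AbsIntegersEquiv`; the decomposition group is
`⟨σ⟩ I_𝔓` modulo the open subgroup `Γ_F`, `FrobeniusGeneration`, and `I_𝔓 ≤ Γ_F` by hypothesis);
`f = f(w|v)` for every `w` (`orderOf_frobenius_eq_inertiaDeg`: a Frobenius of `F` at `𝔔_w`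
restricts to `σ^{f(w|v)}` modulo `I_𝔓 ≤ Γ_F`, so `f ∣ f(w|v)`; and `s_w` acts on `𝓞 F / w` as
`x ↦ x^{q^f}` and trivially, so `f(w|v) ∣ f`, `inertiaDeg_dvd_of_forall_pow_residueCard_pow_eq`);
hence `s_w` is an arithmetic Frobenius at `𝔔_w`.  Everything holds for coefficients in any
commutative ring (for [Ash2003]: characteristic `p`).

## References

* A. Ash, *Smith theory and Hecke operators*, J. Algebra 259 (2003) 43–58, Def. 0.1, Lemma 4.2
  [Ash2003].
* J. Neukirch, *Algebraic Number Theory* (1999), I §9; VII §10, proof of (10.4) (iv)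
  [NeukirchANT1999].
* J.-P. Serre, *Linear representations of finite groups*, GTM 42 (1977), §3.3, §7.3
  [SerreLinearRepresentations1977].
-/

noncomputable section

open scoped NumberField Pointwise
open IsDedekindDomain Polynomial Field

/-! ### Frobenius elements along a finite Galois extension `F/K`, unramified case -/

namespace Literature.NumberTheory.Automorphic

namespace Ash2003

open GaloisRepresentations

section Frobenius

universe u v

variable (K : Type u) (F : Type v) [Field K] [NumberField K] [Field F] [NumberField F]
  [Algebra K F]

-- As in `ArtinFormalismInductionProofs`: the default instance-search limit is slightly too small for
-- the pointwise `Γ_K`-action on the ideals of `\bar ℤ_K` inside the double-coset bookkeeping.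
set_option synthInstance.maxHeartbeats 80000 in
/-- **`Frob_v` has finite order modulo `Γ_F` equal to `f(w|v)`, and its conjugate power is a
Frobenius of `F`** (unramified case).  Let `F/K` be number fields with `res(Γ_F) ⊴ Γ_K`,
`σ ∈ Γ_K` an arithmetic Frobenius at `𝔓 ∣ v` with `I_𝔓 ≤ res(Γ_F)`, `w ∣ v` a place of `F`, `𝔔 ∣ w`
a prime of `\bar ℤ_F` and `τ ∈ Γ_K` with `ι⁻¹ 𝔔 = τ⁻¹ 𝔓`.  If `s ∈ Γ_F` restricts to `τ⁻¹ σ^f τ`,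
`f` the order of `σ res(Γ_F)` in `Γ_K / res(Γ_F)`, then `f = f(w|v)` and `s` is an arithmetic
Frobenius at `𝔔`.  (`f(w|v) ∣ f`: `s` acts on `𝓞 F / w` both trivially and as `x ↦ x^{q^f}`;
`f ∣ f(w|v)`: a Frobenius of `F` at `𝔔` restricts to `σ^{f(w|v)}` modulo `I_𝔓 ≤ res(Γ_F)`.)
Ref: Neukirch, *Algebraic Number Theory*, I §9 (9.4)–(9.5); VII §10, proof of (10.4) (iv), p. 523.
[folklore] -/
theorem orderOf_frobenius_eq_inertiaDeg (hN : (absGaloisRestrict K F).toMonoidHom.range.Normal)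
    {v : HeightOneSpectrum (𝓞 K)} {𝔓 : Ideal (absIntegers (𝓞 K) K)} (h𝔓 : 𝔓 ∈ v.primesAbove)
    (hI : 𝔓.inertia (absoluteGaloisGroup K) ≤ (absGaloisRestrict K F).toMonoidHom.range)
    {σ : absoluteGaloisGroup K} (hσ : IsArithFrobAt (𝓞 K) σ 𝔓)
    {w : HeightOneSpectrum (𝓞 F)} (hwv : w.asIdeal.under (𝓞 K) = v.asIdeal)
    {𝔔 : Ideal (absIntegers (𝓞 F) F)} (h𝔔 : 𝔔 ∈ w.primesAbove) {τ : absoluteGaloisGroup K}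
    (hτ : 𝔔.comap (absIntegersMap K F) = τ⁻¹ • 𝔓) {s : absoluteGaloisGroup F}
    (hs : absGaloisRestrict K F s =
      τ⁻¹ * σ ^ orderOf (σ : absoluteGaloisGroup K ⧸ (absGaloisRestrict K F).toMonoidHom.range) * τ) :
    orderOf (σ : absoluteGaloisGroup K ⧸ (absGaloisRestrict K F).toMonoidHom.range) =
      w.asIdeal.inertiaDeg (𝓞 K) ∧ IsArithFrobAt (𝓞 F) s 𝔔 := by
  set res := absGaloisRestrict K F with hres
  set f := orderOf (σ : absoluteGaloisGroup K ⧸ res.toMonoidHom.range) with hfdef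
  haveI : FiniteDimensional K F := Module.Finite.right ℚ K F
  haveI : 𝔓.IsPrime := h𝔓.1
  haveI : 𝔔.IsPrime := h𝔔.1
  -- `s` acts on `\bar ℤ_F / 𝔔` as `x ↦ x ^ (q ^ f)`
  have hsL : ∀ z : absIntegers (𝓞 F) F, s • z - z ^ v.residueCard ^ f ∈ 𝔔 := by
    rw [← forall_smul_sub_pow_mem_comap_iff K F 𝔔 s, hτ]
    intro x
    have h1 := forall_conj_smul_sub_pow_mem_smul (pow_smul_sub_pow_mem_of_isArithFrobAt h𝔓 hσ f)
      τ⁻¹ x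
    rw [inv_inv] at h1
    change res s • x - _ ∈ _
    rw [hs]
    exact h1
  -- hence `f(w|v) ∣ f`
  have hunder : 𝔔.under (𝓞 F) = w.asIdeal := h𝔔.2.over.symm
  have hdvd1 : w.asIdeal.inertiaDeg (𝓞 K) ∣ f := by
    refine inertiaDeg_dvd_of_forall_pow_residueCard_pow_eq hwv fun x => ?_
    obtain ⟨y, rfl⟩ := Ideal.Quotient.mk_surjective x
    rw [← map_pow, Ideal.Quotient.eq, ← hunder, Ideal.under, Ideal.mem_comap, map_sub, map_pow]
    have := hsL (algebraMap (𝓞 F) (absIntegers (𝓞 F) F) y)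
    rw [smul_algebraMap] at this
    rw [← neg_mem_iff, neg_sub]
    exact this
  -- and `f ∣ f(w|v)`: a Frobenius of `F` at `𝔔` restricts to `σ ^ f(w|v)` modulo `I_𝔓 ≤ res(Γ_F)`
  have hdvd2 : f ∣ w.asIdeal.inertiaDeg (𝓞 K) := by
    obtain ⟨φw, hφw⟩ := HeightOneSpectrum.exists_isArithFrobAt_of_mem_primesAbove_holds h𝔔
    have hqw : w.residueCard = v.residueCard ^ w.asIdeal.inertiaDeg (𝓞 K) :=
      residueCard_eq_pow_inertiaDeg_of_under_eq hwv
    have h1 : ∀ x : absIntegers (𝓞 K) K,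
        res φw • x - x ^ v.residueCard ^ w.asIdeal.inertiaDeg (𝓞 K) ∈ τ⁻¹ • 𝔓 := by
      rw [← hτ, ← hqw]
      exact (forall_smul_sub_pow_mem_comap_iff K F 𝔔 φw _).mpr
        ((HeightOneSpectrum.isArithFrobAt_iff_of_mem_primesAbove h𝔔 φw).mp hφw)
    have h2 : ∀ x : absIntegers (𝓞 K) K,
        (τ * res φw * τ⁻¹) • x - x ^ v.residueCard ^ w.asIdeal.inertiaDeg (𝓞 K) ∈ 𝔓 := fun x => by
      have := forall_conj_smul_sub_pow_mem_smul h1 τ x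
      rwa [smul_inv_smul] at this
    have h3 : τ * res φw * τ⁻¹ * (σ ^ w.asIdeal.inertiaDeg (𝓞 K))⁻¹ ∈
        𝔓.inertia (absoluteGaloisGroup K) :=
      mul_inv_mem_inertia_of_forall_smul_sub_pow_mem h2
        (pow_smul_sub_pow_mem_of_isArithFrobAt h𝔓 hσ _)
    have h4 : τ * res φw * τ⁻¹ * (σ ^ w.asIdeal.inertiaDeg (𝓞 K))⁻¹ ∈ res.toMonoidHom.range :=
      hI h3
    have h5 : τ * res φw * τ⁻¹ ∈ res.toMonoidHom.range :=
      hN.conj_mem (res φw) ⟨φw, rfl⟩ τ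
    have h6 : σ ^ w.asIdeal.inertiaDeg (𝓞 K) ∈ res.toMonoidHom.range := by
      have := res.toMonoidHom.range.mul_mem (res.toMonoidHom.range.inv_mem h4) h5
      rwa [mul_inv_rev, inv_inv, inv_mul_cancel_right] at this
    haveI := hN
    refine orderOf_dvd_of_pow_eq_one ?_
    rw [← QuotientGroup.mk_pow, QuotientGroup.eq_one_iff]
    exact h6
  have hf : f = w.asIdeal.inertiaDeg (𝓞 K) := Nat.dvd_antisymm hdvd2 hdvd1
  refine ⟨hf, ?_⟩
  rw [HeightOneSpectrum.isArithFrobAt_iff_of_mem_primesAbove h𝔔,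
    residueCard_eq_pow_inertiaDeg_of_under_eq hwv, ← hf]
  exact hsL

end Frobenius

end Ash2003

end Literature.NumberTheory.Automorphic

/-! ### The Frobenius characteristic polynomial of the induction of a character -/

namespace Literature.NumberTheory.GaloisRepresentations

section Induce

universe u v

variable (K : Type u) {F : Type v} [Field K] [NumberField K] [Field F] [NumberField F] [Algebra K F]
  [FiniteDimensional K F] [IsGalois K F] {A : Type*} [CommRing A] [TopologicalSpace A] {d : ℕ}

-- One long proof with many local definitions (`set`/`choose`); as in
-- `ArtinFormalismInductionProofs`, the default limits are slightly too small for the elaboration of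
-- the double-coset bookkeeping (pointwise `Γ_K`-action on ideals of `\bar ℤ_K`).
set_option maxHeartbeats 400000 in
set_option synthInstance.maxHeartbeats 80000 in
/-- **Frobenius characteristic polynomial of `Ind_{Γ_F}^{Γ_K} ρ` for a character `ρ`, unramified
case.**  Let `F/K` be a finite Galois extension of number fields of degree `d`, `ρ : Γ_F → GL_1(A)` a
framed character, `v` a finite place of `K`, `𝔓 ∣ v` a prime of `\bar ℤ_K` with `I_𝔓 ≤ res(Γ_F)`
(`v` unramified in `F`) and `σ ∈ Γ_K` an arithmetic Frobenius at `𝔓`.  Then there are primes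
`𝔔_w ∣ w` of `\bar ℤ_F` and arithmetic Frobenii `s_w ∈ Γ_F` at `𝔔_w`, one for each place `w ∣ v` of
`F`, with
`det(X - Ind(ρ)(σ)) = ∏_{w ∣ v} (X^{f(w|v)} - ρ(s_w))`.
(For `ρ` unramified above `v` the values `ρ(s_w)` do not depend on the choices.)  Proof: module
docstring (`Ash2003.charpoly_indMatrix_eq_prod` + the double coset bookkeeping of Neukirch VII §10).
Dot-notation extension of the accepted `FramedGaloisRep`, declared from
`Automorphic/AshSmithTheoryHeckeFrobeniusProofs.lean` by absolute name.
Ref: Neukirch, *Algebraic Number Theory*, VII §10, proof of (10.4) (iv); Serre, *Linear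
representations of finite groups*, §3.3, §7.3. [folklore] -/
theorem FramedGaloisRep.exists_charpoly_induce_eq_prod (hd : Module.finrank K F = d)
    (ρ : FramedGaloisRep F A 1) {v : HeightOneSpectrum (𝓞 K)} {𝔓 : Ideal (absIntegers (𝓞 K) K)}
    (h𝔓 : 𝔓 ∈ v.primesAbove)
    (hI : 𝔓.inertia (absoluteGaloisGroup K) ≤ (absGaloisRestrict K F).toMonoidHom.range)
    {σ : absoluteGaloisGroup K} (hσ : IsArithFrobAt (𝓞 K) σ 𝔓)
    [Fintype {w : HeightOneSpectrum (𝓞 F) // w.under (𝓞 K) = v}] :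
    ∃ (𝔔 : {w : HeightOneSpectrum (𝓞 F) // w.under (𝓞 K) = v} → Ideal (absIntegers (𝓞 F) F))
      (s : {w : HeightOneSpectrum (𝓞 F) // w.under (𝓞 K) = v} → absoluteGaloisGroup F),
      (∀ w, 𝔔 w ∈ w.1.primesAbove ∧ IsArithFrobAt (𝓞 F) (s w) (𝔔 w)) ∧
        FramedRep.charpoly (ρ.induce K hd) σ =
          ∏ w, (X ^ (w.1.asIdeal.inertiaDeg (𝓞 K)) -
            C (((ρ (s w) : GL (Fin 1) A) : Matrix (Fin 1) (Fin 1) A) 0 0)) := by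
  classical
  set res := absGaloisRestrict K F with hres
  set φ : absoluteGaloisGroup F →* absoluteGaloisGroup K := res.toMonoidHom with hφdef
  have hφa : ∀ γ, φ γ = res γ := fun _ => rfl
  have hinj : Function.Injective φ := absGaloisRestrict_injective K F
  haveI hNormal : φ.range.Normal := normal_range_absGaloisRestrict K F
  set r := absGaloisCosetRep K F hd
  have hr := absGaloisCosetRep_bijective K F hd
  -- the character `χ = ρ₀₀ = det ∘ ρ`
  set χ : absoluteGaloisGroup F →* A :=
    (Units.coeHom A).comp (Matrix.GeneralLinearGroup.det.comp ρ.toMonoidHom) with hχdef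
  have hχ : ∀ a, χ a = ((ρ a : GL (Fin 1) A) : Matrix (Fin 1) (Fin 1) A) 0 0 := fun a => by
    change ((Matrix.GeneralLinearGroup.det (ρ a) : Aˣ) : A) = _
    rw [Matrix.GeneralLinearGroup.val_det_apply, Matrix.det_fin_one]
  -- Step A: `det(X - Ind(ρ)(σ)) = det(X - indMatrix φ χ r σ)`
  have hA : FramedRep.charpoly (ρ.induce K hd) σ = (indMatrix φ χ r σ).charpoly := by
    have h1 : ((ρ.induce K hd σ : GL (Fin (d * 1)) A) : Matrix (Fin (d * 1)) (Fin (d * 1)) A) =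
        Matrix.reindex finProdFinEquiv finProdFinEquiv
          (Matrix.reindex (Equiv.prodUnique (Fin d) (Fin 1)).symm
            (Equiv.prodUnique (Fin d) (Fin 1)).symm (indMatrix φ χ r σ)) := by
      rw [FramedGaloisRep.induce_def, FramedRep.induce_apply_coe,
        FramedRep.indFlatHom_apply_eq_reindex]
      congr 1
      ext ⟨i, a⟩ ⟨j, b⟩
      rw [Matrix.comp_apply, Matrix.reindex_apply, Matrix.submatrix_apply, Equiv.symm_symm,
        Equiv.prodUnique_apply, Equiv.prodUnique_apply, indMatrix_apply, indMatrix_apply,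
        dotExtend_matrix_apply hinj, Subsingleton.elim a 0, Subsingleton.elim b 0]
      congr 1
      funext h
      exact (hχ h).symm
    change ((ρ.induce K hd σ : GL (Fin (d * 1)) A) : Matrix (Fin (d * 1)) (Fin (d * 1)) A).charpoly = _
    rw [h1, Matrix.charpoly_reindex, Matrix.charpoly_reindex]
  -- Step B: the places `w ∣ v`, primes `𝔔_w ∣ w` of `\bar ℤ_F`, and `τ_w ∈ Γ_K` with
  -- `ι⁻¹ 𝔔_w = τ_w⁻¹ 𝔓`
  have hwv : ∀ w : {w : HeightOneSpectrum (𝓞 F) // w.under (𝓞 K) = v},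
      w.1.asIdeal.under (𝓞 K) = v.asIdeal := fun w => congrArg HeightOneSpectrum.asIdeal w.2
  set ι := absIntegersMap K F with hι
  haveI h𝔓p : 𝔓.IsPrime := h𝔓.1
  have hdata : ∀ w : {w : HeightOneSpectrum (𝓞 F) // w.under (𝓞 K) = v},
      ∃ 𝔔 : Ideal (absIntegers (𝓞 F) F), ∃ τ : absoluteGaloisGroup K,
        𝔔 ∈ w.1.primesAbove ∧ τ • 𝔔.comap ι = 𝔓 := by
    intro w
    obtain ⟨𝔔, h𝔔⟩ := w.1.primesAbove_nonempty
    obtain ⟨τ, hτ⟩ := HeightOneSpectrum.exists_smul_eq_of_mem_primesAbove_holds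
      (comap_absIntegersMap_mem_primesAbove (hwv w) h𝔔) h𝔓
    exact ⟨𝔔, τ, h𝔔, hτ⟩
  choose 𝔔 τ h𝔔 hτ using hdata
  have h𝔔p : ∀ w, (𝔔 w).IsPrime := fun w => (h𝔔 w).1
  have hcomap : ∀ w, (𝔔 w).comap ι = (τ w)⁻¹ • 𝔓 := fun w => by
    rw [← hτ w, inv_smul_smul]
  have hunder : ∀ w, (𝔔 w).under (𝓞 F) = w.1.asIdeal := fun w => (h𝔔 w).2.over.symm
  -- `σ ^ f ∈ Γ_F` and the elements `s_w`
  have hσf : σ ^ orderOf (σ : absoluteGaloisGroup K ⧸ φ.range) ∈ φ.range := by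
    rw [← QuotientGroup.eq_one_iff, QuotientGroup.mk_pow]
    exact pow_orderOf_eq_one _
  have hsex : ∀ w : {w : HeightOneSpectrum (𝓞 F) // w.under (𝓞 K) = v},
      ∃ s : absoluteGaloisGroup F,
        φ s = (τ w)⁻¹ * σ ^ orderOf (σ : absoluteGaloisGroup K ⧸ φ.range) * τ w := fun w => by
    have := hNormal.conj_mem _ hσf (τ w)⁻¹
    rw [inv_inv] at this
    exact this
  choose s hs using hsex
  -- `σ ∈ D_𝔓`, `Γ_F` open
  set D := 𝔓.decompositionSubgroup (absoluteGaloisGroup K) with hD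
  have hσD : σ ∈ D := hσ.mem_stabilizer
  have hopen : IsOpen (φ.range : Set (absoluteGaloisGroup K)) := by
    rw [MonoidHom.coe_range]
    exact isOpen_range_absGaloisRestrict K F
  -- Step B1: every `x ∈ Γ_K` lies in some `σ^t τ_w Γ_F`
  have hcov : ∀ x : absoluteGaloisGroup K, ∃ w, ∃ t : ℕ, ∃ a : absoluteGaloisGroup F,
      x = σ ^ t * τ w * φ a := by
    intro x
    have h𝔓x : x⁻¹ • 𝔓 ∈ v.primesAbove := smul_mem_primesAbove h𝔓 x⁻¹
    set 𝔔x : Ideal (absIntegers (𝓞 F) F) :=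
      (x⁻¹ • 𝔓).comap ((absIntegersEquiv K F).symm : absIntegers (𝓞 F) F →+* absIntegers (𝓞 K) K)
      with h𝔔x
    have h𝔔xc : 𝔔x.comap ι = x⁻¹ • 𝔓 := by
      rw [h𝔔x, hι, ← coe_absIntegersEquiv]
      exact Ideal.comap_of_equiv _
    haveI : 𝔔x.IsPrime := by
      haveI := h𝔓x.1
      exact Ideal.comap_isPrime _ _
    have h𝔔xv : 𝔔x.comap (absIntegersMap K F) ∈ v.primesAbove := by
      rw [← hι, h𝔔xc]
      exact h𝔓x
    obtain ⟨w₀, hw₀, h𝔔xw, -⟩ :=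
      exists_heightOneSpectrum_of_comap_absIntegersMap_mem_primesAbove h𝔔xv
    let w : {w : HeightOneSpectrum (𝓞 F) // w.under (𝓞 K) = v} := ⟨w₀, HeightOneSpectrum.ext hw₀⟩
    obtain ⟨γ, hγ⟩ := HeightOneSpectrum.exists_smul_eq_of_mem_primesAbove_holds h𝔔xw (h𝔔 w)
    have key : (φ γ * x⁻¹) • 𝔓 = (τ w)⁻¹ • 𝔓 := by
      rw [mul_smul, ← h𝔔xc, hφa, ← comap_absIntegersMap_smul, hγ, ← hι, hcomap w]
    have hd' : τ w * φ γ * x⁻¹ ∈ D := by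
      rw [hD, Ideal.mem_decompositionSubgroup_iff, mul_assoc, mul_smul, key, smul_inv_smul]
    obtain ⟨n, i, u, hi, hu, heq⟩ :=
      exists_eq_frobenius_pow_mul_of_mem_decompositionSubgroup h𝔓 hσ hopen (D.inv_mem hd')
    have hiu : i * u ∈ φ.range := φ.range.mul_mem (hI hi) hu
    have hconj : (τ w)⁻¹ * (i * u) * τ w * φ γ ∈ φ.range := by
      refine φ.range.mul_mem ?_ ⟨γ, rfl⟩
      have := hNormal.conj_mem _ hiu (τ w)⁻¹
      rwa [inv_inv] at this
    obtain ⟨a, ha⟩ := hconj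
    refine ⟨w, n, a, ?_⟩
    rw [ha]
    calc x = (τ w * φ γ * x⁻¹)⁻¹ * τ w * φ γ := by group
      _ = σ ^ n * i * u * τ w * φ γ := by rw [heq]
      _ = σ ^ n * τ w * ((τ w)⁻¹ * (i * u) * τ w * φ γ) := by group
  -- Step B2: distinct places give distinct double cosets
  have hdisj : ∀ (w w' : {w : HeightOneSpectrum (𝓞 F) // w.under (𝓞 K) = v}) (t : ℕ)
      (a : absoluteGaloisGroup F), τ w' = σ ^ t * τ w * φ a → w = w' := by
    intro w w' t a hEq
    have hd' : (σ ^ t)⁻¹ • 𝔓 = 𝔓 := by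
      rw [inv_smul_eq_iff]
      exact (Ideal.mem_decompositionSubgroup_iff.mp (D.pow_mem hσD t)).symm
    have hij : (𝔔 w').comap ι = (a⁻¹ • 𝔔 w).comap ι := by
      rw [hι, comap_absIntegersMap_smul, ← hι, hcomap w, hcomap w', hEq, mul_inv_rev, mul_inv_rev,
        mul_smul, mul_smul, hd', map_inv, hφa]
    have hQ : 𝔔 w' = a⁻¹ • 𝔔 w :=
      Ideal.comap_injective_of_surjective _ (absIntegersMap_surjective K F) hij
    apply Subtype.ext
    apply HeightOneSpectrum.ext
    rw [← hunder w, ← hunder w', hQ, under_smul_absIntegers]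
  -- Step C: `f = f(w|v)` and `s_w` is a Frobenius at `𝔔_w`
  have hC : ∀ w : {w : HeightOneSpectrum (𝓞 F) // w.under (𝓞 K) = v},
      orderOf (σ : absoluteGaloisGroup K ⧸ φ.range) = w.1.asIdeal.inertiaDeg (𝓞 K) ∧
        IsArithFrobAt (𝓞 F) (s w) (𝔔 w) := fun w =>
    Automorphic.Ash2003.orderOf_frobenius_eq_inertiaDeg K F hNormal h𝔓 hI hσ (hwv w) (h𝔔 w)
      (hcomap w) (hs w)
  -- Step D: assemble
  refine ⟨𝔔, s, fun w => ⟨h𝔔 w, (hC w).2⟩, ?_⟩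
  rw [hA, Automorphic.Ash2003.charpoly_indMatrix_eq_prod hinj χ hr σ τ s hcov hdisj hs]
  exact Finset.prod_congr rfl fun w _ => by rw [(hC w).1, hχ]

end Induce

end Literature.NumberTheory.GaloisRepresentations
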